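import Literature.NumberTheory.Weil1964.ArchFollandDualPairPlaceSection
import Literature.RepresentationTheory.KonnoKonno2007.RealUnitaryDualPairBallFrame
import HarnessLib

/-!
# The pair section at one real place in the sign frames: `U(P_v,Q_v) × U(R_v,S_v) →* U(J_V)(E ⊗ ℝ) × U(J_W)(E ⊗ ℝ)`

Topic `NumberTheory/Weil1964`; namespace `Literature.NumberTheory.Weil1964`.  KERNEL MATHEMATICS ONLY: two explicit definitions
(a topological group isomorphism and a group homomorphism) and proved theorems; no `def … : Prop` record, no axiom, no proof hole.

`ArchFollandDualPairPlaceSection` (part A) gives the pair section `archPairSingle (wOf v₁)` in local-group currency and the pair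
frame `archPairFrame v₁ : U(σ_{w(v₁)} J_V)(ℂ) × U(σ_{w(v₁)} J_W)(ℂ) →* U(P_{v₁},Q_{v₁}) × U(R_{v₁},S_{v₁})` (continuous, bijective, the two
Sylvester frames `toUForm`).  Here the frame is upgraded to a TOPOLOGICAL GROUP ISOMORPHISM and inverted:

* §1 **`archPairFrameEquiv v₁ : U(σ_{w(v₁)} J_V)(ℂ) × U(σ_{w(v₁)} J_W)(ℂ) ≃ₜ* U(P_{v₁},Q_{v₁}) × U(R_{v₁},S_{v₁})`** — factor by
  factor the chain `unitaryGroupOfFormCongrOfEq ≫ unitaryGroupOfFormReindex ≫ subgroupCongrT` of which `toUForm` is the underlying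
  homomorphism (`ArchFollandDualPair` §4), at the arch-local Sylvester datum; `coe_archPairFrameEquiv : ⇑ = archPairFrame v₁`;
* §2 **`archPairSection v₁ : U(P_{v₁},Q_{v₁}) × U(R_{v₁},S_{v₁}) →* U(J_V)(E ⊗ ℝ) × U(J_W)(E ⊗ ℝ)`** := `archPairSingle (wOf v₁) ∘
  (archPairFrameEquiv v₁)⁻¹` — continuous, injective — with the SECTION PROPERTY **`archPairPlace_archPairSection :
  (v ↦ archPairPlace v (archToAdelic (archPairSection v₁ g).1, archToAdelic (archPairSection v₁ g).2)) = Pi.mulSingle v₁ g`**, i.e. the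
  hypothesis `hsec` of `ArchPlacePhaseHomBlock.coe_reindexSp_piPhaseHom_comp_section` for the (J-arch) phase homomorphism, and
  `hs_cont` of the block pair of `Model/ArchKTypeJunction` § 2.

Everything is PROVED; nothing cited is a hypothesis.

## References

* [BorelJacquet1979] A. Borel, H. Jacquet, Proc. Symp. Pure Math. 33.1 (1979), §4.1 (factor inclusions `G(F_v) ↪ G_∞`).
* [PlatonovRapinchuk1994] V. Platonov, A. Rapinchuk, *Algebraic Groups and Number Theory* (1994), §2.3 (Sylvester frames of hermitian forms).
* [KonnoKonno2007] K. Konno, T. Konno, Kyushu J. Math. 61 (2007), §3.1 (3.1) (sign frames of `U(p,q) × U(r,s)`).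

## Provenance

LEAN-IN-TREE rule (2026-08-18), pub-hodgecm model-construction sub-cell, discharge seat mc-discharge-3 (ticket D-3 row (T4) part B, desk
(XXXXX′)(2)).  Nothing here is a claim of the manuscripts adjudicated by that cell.
-/

set_option autoImplicit false

noncomputable section

open NumberField NumberField.InfinitePlace

namespace Literature.NumberTheory.Weil1964

open Literature.NumberTheory.Automorphic Literature.NumberTheory.Automorphic.UnitaryGroup
open Literature.RepresentationTheory.KonnoKonno2007 Literature.RepresentationTheory.KonnoKonno2007.RealDualPair

section PlaceSectionFrame

variable {F : Type} [Field F] [NumberField F] (E : Type) [Field E] [NumberField E] [Algebra F E] (c : E ≃ₐ[F] E)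
  (N M : ℕ) (hc : c ≠ 1)
  (wOf : {v : InfinitePlace F // v.IsReal} → {w : InfinitePlace E // w.IsComplex})
  (hw : ∀ v, c • (wOf v).1 = (wOf v).1) (hover : ∀ v, (wOf v).1.comap (algebraMap F E) = v.1)
  (tV : Fin N → F) (tW : Fin M → F) {JV : Matrix (Fin N) (Fin N) E} {JW : Matrix (Fin M) (Fin M) E}
  (hJV : JV = (Matrix.diagonal tV).map (algebraMap F E)) (hJW : JW = (Matrix.diagonal tW).map (algebraMap F E))
  {P Q R S : {v : InfinitePlace F // v.IsReal} → Type*} [∀ v, Fintype (P v)] [∀ v, DecidableEq (P v)]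
  [∀ v, Fintype (Q v)] [∀ v, DecidableEq (Q v)] [∀ v, Fintype (R v)] [∀ v, DecidableEq (R v)]
  [∀ v, Fintype (S v)] [∀ v, DecidableEq (S v)]
  (εV : ∀ v, Fin N ≃ P v ⊕ Q v) (εW : ∀ v, Fin M ≃ R v ⊕ S v)
  {DV : {v : InfinitePlace F // v.IsReal} → Fin N → ℝ} {DW : {v : InfinitePlace F // v.IsReal} → Fin M → ℝ}
  (hDV0 : ∀ v i, DV v i ≠ 0) (hDW0 : ∀ v j, DW v j ≠ 0) {cV cW : {v : InfinitePlace F // v.IsReal} → ℝ}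
  (hcV : ∀ v, cV v ≠ 0) (hcW : ∀ v, cW v ≠ 0)
  (htV : ∀ v i, embedding_of_isReal v.2 (tV i) = cV v * signOf (εV v i) * DV v i ^ 2)
  (htW : ∀ v j, embedding_of_isReal v.2 (tW j) = cW v * signOf (εW v j) * DW v j ^ 2)
  (hfix : ∀ w : InfinitePlace E, c • w = w) (v₁ : {v : InfinitePlace F // v.IsReal})

/-! ## §1 The pair frame as a topological group isomorphism -/

/-- **The pair frame at `v₁` as a topological group isomorphism**: on each factor the chain
`U(σ_{w(v₁)} J)(ℂ) ≃ₜ* U((c′ • diag(1_P, −1_Q))^ε)(ℂ) ≃ₜ* U(c′ • diag(1_P, −1_Q))(ℂ) ≃ₜ* U(P,Q)` (conjugation by the adapted scaling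
`diag(D)`, reindexing by the sign frame `ε`, `U(c′ H) = U(H)`), whose underlying homomorphism is weil-2's `toUForm`.
[cite: PlatonovRapinchuk1994, §2.3; KonnoKonno2007, §3.1 (3.1)] -/
def archPairFrameEquiv :
    (archLocal E N JV (wOf v₁) × archLocal E M JW (wOf v₁)) ≃ₜ* Ginf (P v₁) (Q v₁) (R v₁) (S v₁) :=
  let eV : archLocal E N JV (wOf v₁) ≃ₜ* UForm (P v₁) (Q v₁) :=
    (unitaryGroupOfFormCongrOfEq (starRingEnd ℂ) (scaleGL (DV v₁) (hDV0 v₁))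
        ((((cV v₁ : ℝ) : ℂ) • signForm (P v₁) (Q v₁)).submatrix (εV v₁) (εV v₁)) (JV.map (wOf v₁).1.embedding)
        ((formCongr_scaleGL_smul_signForm (εV v₁) (hDV0 v₁) (cV v₁) (htV v₁)).trans
          (archLocalForm_diagonal E c N hc wOf hw hover tV hJV v₁).symm)).trans
      ((unitaryGroupOfFormReindex (starRingEnd ℂ) (εV v₁) (((cV v₁ : ℝ) : ℂ) • signForm (P v₁) (Q v₁))).trans
        (subgroupCongrT (unitaryGroupOfForm_smul_eq (signForm (P v₁) (Q v₁)) (hcV v₁))))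
  let eW : archLocal E M JW (wOf v₁) ≃ₜ* UForm (R v₁) (S v₁) :=
    (unitaryGroupOfFormCongrOfEq (starRingEnd ℂ) (scaleGL (DW v₁) (hDW0 v₁))
        ((((cW v₁ : ℝ) : ℂ) • signForm (R v₁) (S v₁)).submatrix (εW v₁) (εW v₁)) (JW.map (wOf v₁).1.embedding)
        ((formCongr_scaleGL_smul_signForm (εW v₁) (hDW0 v₁) (cW v₁) (htW v₁)).trans
          (archLocalForm_diagonal E c M hc wOf hw hover tW hJW v₁).symm)).trans
      ((unitaryGroupOfFormReindex (starRingEnd ℂ) (εW v₁) (((cW v₁ : ℝ) : ℂ) • signForm (R v₁) (S v₁))).trans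
        (subgroupCongrT (unitaryGroupOfForm_smul_eq (signForm (R v₁) (S v₁)) (hcW v₁))))
  { eV.toMulEquiv.prodCongr eW.toMulEquiv with
    continuous_toFun := eV.continuous.prodMap eW.continuous
    continuous_invFun := eV.symm.continuous.prodMap eW.symm.continuous }

/-- **the isomorphism IS the pair frame of part A**: `⇑(archPairFrameEquiv v₁) = archPairFrame v₁` (both are `(toUForm, toUForm)`).
[folklore] -/
theorem coe_archPairFrameEquiv :
    (⇑(archPairFrameEquiv E c N M hc wOf hw hover tV tW hJV hJW εV εW hDV0 hDW0 hcV hcW htV htW v₁) :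
        archLocal E N JV (wOf v₁) × archLocal E M JW (wOf v₁) → Ginf (P v₁) (Q v₁) (R v₁) (S v₁)) =
      archPairFrame E c N M hc wOf hw hover tV tW hJV hJW εV εW hDV0 hDW0 hcV hcW htV htW hfix v₁ := by
  funext u
  rw [archPairFrame_apply_eq_toUForm]
  rfl

/-- pointwise form. [folklore] -/
theorem archPairFrameEquiv_apply (u : archLocal E N JV (wOf v₁) × archLocal E M JW (wOf v₁)) :
    archPairFrameEquiv E c N M hc wOf hw hover tV tW hJV hJW εV εW hDV0 hDW0 hcV hcW htV htW v₁ u =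
      archPairFrame E c N M hc wOf hw hover tV tW hJV hJW εV εW hDV0 hDW0 hcV hcW htV htW hfix v₁ u :=
  congrFun (coe_archPairFrameEquiv E c N M hc wOf hw hover tV tW hJV hJW εV εW hDV0 hDW0 hcV hcW htV htW hfix v₁) u

/-- the frame of the inverse-framed element is the element. [folklore] -/
theorem archPairFrame_archPairFrameEquiv_symm (g : Ginf (P v₁) (Q v₁) (R v₁) (S v₁)) :
    archPairFrame E c N M hc wOf hw hover tV tW hJV hJW εV εW hDV0 hDW0 hcV hcW htV htW hfix v₁
        ((archPairFrameEquiv E c N M hc wOf hw hover tV tW hJV hJW εV εW hDV0 hDW0 hcV hcW htV htW v₁).symm g) = g := by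
  rw [← archPairFrameEquiv_apply E c N M hc wOf hw hover tV tW hJV hJW εV εW hDV0 hDW0 hcV hcW htV htW hfix v₁,
    ContinuousMulEquiv.apply_symm_apply]

/-! ## §2 The pair section in the sign frames -/

/-- **The pair section at the real place `v₁` in the sign frames**: `g ↦ archPairSingle (wOf v₁) ((archPairFrameEquiv v₁)⁻¹ g)` —
the element of `U(J_V)(E ⊗ ℝ) × U(J_W)(E ⊗ ℝ)` whose `wOf v₁`-components, read in the sign frames, are `g` and whose other components
are `1`. [cite: BorelJacquet1979, §4.1; KonnoKonno2007, §3.1 (3.1)] -/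
def archPairSection : Ginf (P v₁) (Q v₁) (R v₁) (S v₁) →* UnitaryGroup.arch F E c N JV × UnitaryGroup.arch F E c M JW :=
  (archPairSingle F E c N M JV JW hc hfix (wOf v₁)).comp
    (archPairFrameEquiv E c N M hc wOf hw hover tV tW hJV hJW εV εW hDV0 hDW0 hcV hcW htV htW v₁).symm.toMulEquiv.toMonoidHom

/-- unfolding. [folklore] -/
theorem archPairSection_apply (g : Ginf (P v₁) (Q v₁) (R v₁) (S v₁)) :
    archPairSection E c N M hc wOf hw hover tV tW hJV hJW εV εW hDV0 hDW0 hcV hcW htV htW hfix v₁ g =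
      archPairSingle F E c N M JV JW hc hfix (wOf v₁)
        ((archPairFrameEquiv E c N M hc wOf hw hover tV tW hJV hJW εV εW hDV0 hDW0 hcV hcW htV htW v₁).symm g) := rfl

/-- `archPairSection v₁` is continuous (`hs_cont`). [folklore] -/
theorem continuous_archPairSection :
    Continuous (archPairSection E c N M hc wOf hw hover tV tW hJV hJW εV εW hDV0 hDW0 hcV hcW htV htW hfix v₁) :=
  (continuous_archPairSingle F E c N M JV JW hc hfix (wOf v₁)).comp
    (archPairFrameEquiv E c N M hc wOf hw hover tV tW hJV hJW εV εW hDV0 hDW0 hcV hcW htV htW v₁).symm.continuous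

/-- `archPairSection v₁` is injective. [folklore] -/
theorem archPairSection_injective :
    Function.Injective (archPairSection E c N M hc wOf hw hover tV tW hJV hJW εV εW hDV0 hDW0 hcV hcW htV htW hfix v₁) :=
  (archPairSingle_injective F E c N M JV JW hc hfix (wOf v₁)).comp
    (archPairFrameEquiv E c N M hc wOf hw hover tV tW hJV hJW εV εW hDV0 hDW0 hcV hcW htV htW v₁).symm.injective

/-- **The section property**: the place components of `archPairSection v₁ g` are `g` at `v₁` and `1` elsewhere — the hypothesis `hsec`
of `ArchPlacePhaseHomBlock.coe_reindexSp_piPhaseHom_comp_section` for `ϖ := (v ↦ archPairPlace v (archToAdelic ·, archToAdelic ·))`.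
[cite: BorelJacquet1979, §4.1; KonnoKonno2007, §3.1 (3.1)] -/
theorem archPairPlace_archPairSection [DecidableEq {v : InfinitePlace F // v.IsReal}] (g : Ginf (P v₁) (Q v₁) (R v₁) (S v₁)) :
    (fun v => archPairPlace E c N M hc wOf hw hover tV tW hJV hJW εV εW hDV0 hDW0 hcV hcW htV htW v
        (UnitaryGroup.archToAdelic F E c N JV
            (archPairSection E c N M hc wOf hw hover tV tW hJV hJW εV εW hDV0 hDW0 hcV hcW htV htW hfix v₁ g).1,
          UnitaryGroup.archToAdelic F E c M JW
            (archPairSection E c N M hc wOf hw hover tV tW hJV hJW εV εW hDV0 hDW0 hcV hcW htV htW hfix v₁ g).2)) =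
      Pi.mulSingle (M := fun v => Ginf (P v) (Q v) (R v) (S v)) v₁ g :=
  archPairPlace_archPairSingle_of_frame_eq E c N M hc wOf hw hover tV tW hJV hJW εV εW hDV0 hDW0 hcV hcW htV htW hfix v₁ _
    (archPairFrame_archPairFrameEquiv_symm E c N M hc wOf hw hover tV tW hJV hJW εV εW hDV0 hDW0 hcV hcW htV htW hfix v₁ g)

/-- pointwise: at the place itself. [folklore] -/
theorem archPairPlace_archPairSection_self (g : Ginf (P v₁) (Q v₁) (R v₁) (S v₁)) :
    archPairPlace E c N M hc wOf hw hover tV tW hJV hJW εV εW hDV0 hDW0 hcV hcW htV htW v₁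
        (UnitaryGroup.archToAdelic F E c N JV
            (archPairSection E c N M hc wOf hw hover tV tW hJV hJW εV εW hDV0 hDW0 hcV hcW htV htW hfix v₁ g).1,
          UnitaryGroup.archToAdelic F E c M JW
            (archPairSection E c N M hc wOf hw hover tV tW hJV hJW εV εW hDV0 hDW0 hcV hcW htV htW hfix v₁ g).2) = g :=
  archPairFrame_archPairFrameEquiv_symm E c N M hc wOf hw hover tV tW hJV hJW εV εW hDV0 hDW0 hcV hcW htV htW hfix v₁ g

/-- pointwise: away from the place. [folklore] -/
theorem archPairPlace_archPairSection_of_ne {v : {v : InfinitePlace F // v.IsReal}} (hv : v ≠ v₁)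
    (g : Ginf (P v₁) (Q v₁) (R v₁) (S v₁)) :
    archPairPlace E c N M hc wOf hw hover tV tW hJV hJW εV εW hDV0 hDW0 hcV hcW htV htW v
        (UnitaryGroup.archToAdelic F E c N JV
            (archPairSection E c N M hc wOf hw hover tV tW hJV hJW εV εW hDV0 hDW0 hcV hcW htV htW hfix v₁ g).1,
          UnitaryGroup.archToAdelic F E c M JW
            (archPairSection E c N M hc wOf hw hover tV tW hJV hJW εV εW hDV0 hDW0 hcV hcW htV htW hfix v₁ g).2) = 1 :=
  archPairPlace_archPairSingle_of_ne E c N M hc wOf hw hover tV tW hJV hJW εV εW hDV0 hDW0 hcV hcW htV htW hfix v₁ hv _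

end PlaceSectionFrame

end Literature.NumberTheory.Weil1964
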